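import Mathlib.Data.Fintype.Card
import Mathlib.Data.Fintype.Basic
import Mathlib.Algebra.Group.Basic
import Mathlib.Data.List.NodupEquivFin
import Literature.Combinatorics.Additive.TripleProductProperty
import Literature.Computability.Complexity.CardinalityCCNF
import HarnessLib

/-!
# A SAT encoding of "the group `G` has a TPP triple of sizes `≥ (a, b, c)`"

The **TPP → CNF encoder** of the compute infrastructure (consumed by the LRAT UNSAT importer
`Computability/Complexity/LRATImport.lean`): for a finite group given by a multiplication table
`T : GroupTable N` on `Fin N` — either exactly (`T.IsTableOf G e` for a numbering `e : G ≃ Fin N`,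
e.g. `GroupTable.ofEquiv e`, `GroupTable.ofList l`) or *inside* `Fin N` (`T.IsPartialTableOf G ι`
for an injection `ι : G → Fin N` whose image is the mask `T.valid`; e.g. `GL₂(𝔽_p)` inside the
`p⁴` matrices coded in radix `p`, a subgroup inside its parent's table) — and thresholds
`a, b, c ≥ 1`, the plain CNF `tppCNF T a b c : CNF ℕ` is satisfiable **iff** `G` contains
`S, T, U` with the triple product property (the tree's `TripleProductProperty`, Cohn–Umans 2003,
Def. 2.1) and `|S| ≥ a`, `|T| ≥ b`, `|U| ≥ c` (`tppCNF_satisfiable_iff_of_partial`,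
`tppCNF_satisfiable_iff`; fully proved). So an UNSAT certificate imported for `tppCNF T a b c` is
a Lean proof that `G` realizes no `⟨a', b', c'⟩` with `a' ≥ a, b' ≥ b, c' ≥ c`
(`not_exists_tpp_of_not_satisfiable(_of_partial)`).

## The encoding (after Hedtke–Murthy 2012, Defs. 1.1–1.2, 2.8 and Lemma 2.9)

Variables `TPPVar N`: `mem t g` ("`g ∈ X_t`", `t : Fin 3`, the three unknown sets) and `quot t d`
(an *upper bound* for "`d ∈ Q(X_t) = X_t X_t⁻¹`", the right quotient set of Def. 1.1). Clauses:

* `¬mem t i` for every point `i` outside the mask `T.valid` (not a group element);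
* `mem t 1` for each `t` — w.l.o.g. the triple is *basic*, `1 ∈ S ∩ T ∩ U` (Def. 2.8; by Lemma
  2.9 right translates `(Sa, Tb, Uc)` of a TPP triple are TPP triples, `exists_basic_tpp`);
* `¬mem t g ∨ ¬mem t h ∨ quot t (g h⁻¹)` for all `t, g, h` (so `Q(X_t) ⊆ {d : quot t d}`);
* `¬quot 0 d₁ ∨ ¬quot 1 d₂ ∨ ¬quot 2 d₃` for all `d₁ d₂` with `d₃ = (d₁ d₂)⁻¹` and
  `(d₁, d₂, d₃) ≠ (1, 1, 1)` — the TPP in quotient form, Def. 1.2: "`q₁ q₂ q₃ = 1` with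
  `qᵢ ∈ Q(Xᵢ)` forces `q₁ = q₂ = q₃ = 1`";
* the cardinality constraints `|X_0| ≥ a`, `|X_1| ≥ b`, `|X_2| ≥ c` (sequential counters,
  `CardinalityCCNF.lean`).

`4|G|² + 2` clauses of width `≤ 3` (`3|G|²` quotient, `|G|² - 1` TPP, `3` unit; quotient and
TPP clauses range over the valid points only) plus the `3(N - |G|)` mask clauses and the
counters; base variables are numbered `mem t g ↦ tN + g`, `quot t d ↦ 3N + tN + d`
(`TPPVar.code`, injective, `< 6N`), the counter bits follow (`CCNF.toCNF … (6N)`). Sanity values (SAT solver on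
`CNF.toDimacs (tppCNF (ℤ/N) a b c)`): `ℤ/4, ℤ/5, ℤ/6, ℤ/7` with `(2,2,2)` UNSAT, `ℤ/8` with
`(2,2,2)` SAT (`{0,1}, {0,2}, {0,4}`), `ℤ/6 (3,2,1)`, `ℤ/9 (3,3,1)`, `ℤ/12 (3,2,2)` SAT — as the
abelian bound `abc ≤ |G|` predicts.

## Certifying nonexistence (see `TPPCertificateZMod7.lean` for the complete template)

Give the group by a kernel-evaluable table `T : GroupTable N` (e.g. `Fin` arithmetic, or an
explicit array) together with `hT : T.IsTableOf G e` (or `T.IsPartialTableOf G ι`); print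
`CNF.toDimacs (tppCNF T a b c)` from a scratch file; refute it with CaDiCaL
(`--lrat=true --binary=false`) in a `kit compute` job; import the text LRAT proof with
`CNF.not_satisfiable_of_reify` (lane B) or `CNF.not_satisfiable_of_verifyCert` (lane A) of
`LRATImport.lean`; conclude with `not_exists_tpp_of_not_satisfiable hT`. Instances: `N ≤ 60`
keeps the CNF below `2·10⁴` clauses; certificates above a few hundred KB must be split by cubes
(`CNF.not_satisfiable_of_split`).

## References

* H. Cohn, C. Umans, FOCS 2003, Def. 2.1 (TPP; quotient sets `Q(S)`). [cite: CohnUmans2003, Def. 2.1]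
* I. Hedtke, S. Murthy, *Search and test algorithms for triple product property triples*, Groups
  Complex. Cryptol. 4 (2012), arXiv:1104.5097: Def. 1.1 (right quotient), Def. 1.2 (TPP via
  quotient sets), Def. 2.8 (basic TPP triple), Lemma 2.9 (translates of TPP triples).
  [cite: HedtkeMurthy2012, Def. 1.2]
* C. Sinz, CP 2005, §2 (cardinality constraints). [cite: Sinz2005, §2]
-/

namespace Literature.Combinatorics.Additive

open Literature.Computability.Complexity

universe u

/-! ### Multiplication tables -/

/-- The data of a group structure on (a part of) `Fin N`: multiplication, inversion, unit, and a
mask `valid` of the points that are group elements (default: all; no axioms — the link to an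
actual group is `GroupTable.IsTableOf` / `GroupTable.IsPartialTableOf`). [folklore] -/
structure GroupTable (N : ℕ) where
  /-- the multiplication table (arbitrary on invalid points) -/
  mul : Fin N → Fin N → Fin N
  /-- the inversion table (arbitrary on invalid points) -/
  inv : Fin N → Fin N
  /-- the index of the unit -/
  one : Fin N
  /-- the mask of the points that are group elements -/
  valid : Fin N → Bool := fun _ => true

namespace GroupTable

variable {N : ℕ}

/-- `T` is the multiplication table of the group `G` in the numbering `e : G ≃ Fin N` (all points
valid). [folklore] -/
structure IsTableOf (T : GroupTable N) (G : Type u) [Group G] (e : G ≃ Fin N) : Prop where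
  /-- multiplication is transported multiplication -/
  mul_eq : ∀ x y : G, T.mul (e x) (e y) = e (x * y)
  /-- inversion is transported inversion -/
  inv_eq : ∀ x : G, T.inv (e x) = e x⁻¹
  /-- the unit is the transported unit -/
  one_eq : T.one = e 1
  /-- every point is a group element -/
  valid_eq : ∀ i, T.valid i = true

/-- `T` contains the multiplication table of the group `G` along the injection `ι : G → Fin N`,
whose image is exactly the mask `T.valid` (e.g. a matrix group inside all matrices, a subgroup
inside its parent). [folklore] -/
structure IsPartialTableOf (T : GroupTable N) (G : Type u) [Group G] (ι : G → Fin N) : Prop where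
  /-- distinct elements have distinct codes -/
  injective : Function.Injective ι
  /-- the valid points are exactly the codes of group elements -/
  valid_iff : ∀ i, T.valid i = true ↔ ∃ g, ι g = i
  /-- multiplication is correct on codes -/
  mul_eq : ∀ x y : G, T.mul (ι x) (ι y) = ι (x * y)
  /-- inversion is correct on codes -/
  inv_eq : ∀ x : G, T.inv (ι x) = ι x⁻¹
  /-- the unit is the code of the unit -/
  one_eq : T.one = ι 1

/-- An exact table is a partial table along the numbering. [folklore] -/
theorem IsTableOf.isPartialTableOf {T : GroupTable N} {G : Type u} [Group G] {e : G ≃ Fin N}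
    (h : T.IsTableOf G e) : T.IsPartialTableOf G e where
  injective := e.injective
  valid_iff i := by simpa [h.valid_eq i] using ⟨e.symm i, e.apply_symm_apply i⟩
  mul_eq := h.mul_eq
  inv_eq := h.inv_eq
  one_eq := h.one_eq

/-- The multiplication table of a group along a numbering of its elements. [folklore] -/
def ofEquiv {G : Type u} [Group G] (e : G ≃ Fin N) : GroupTable N where
  mul i j := e (e.symm i * e.symm j)
  inv i := e (e.symm i)⁻¹
  one := e 1

/-- `ofEquiv e` is the table of `G` along `e`. [folklore] -/
theorem ofEquiv_isTableOf {G : Type u} [Group G] (e : G ≃ Fin N) : (ofEquiv e).IsTableOf G e where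
  mul_eq x y := by simp [ofEquiv]
  inv_eq x := by simp [ofEquiv]
  one_eq := rfl
  valid_eq _ := rfl

end GroupTable

/-- The numbering of a type by a duplicate-free exhaustive list of its elements (position in
the list; computable, via `List.Nodup.getEquivOfForallMemList`). [folklore] -/
def equivFinOfList {G : Type u} [DecidableEq G] (l : List G) (hnd : l.Nodup) (hall : ∀ g, g ∈ l) :
    G ≃ Fin l.length :=
  (hnd.getEquivOfForallMemList l hall).symm

/-- The multiplication table of a group along a duplicate-free exhaustive list of its elements.
[folklore] -/
def GroupTable.ofList {G : Type u} [Group G] [DecidableEq G] (l : List G) (hnd : l.Nodup)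
    (hall : ∀ g, g ∈ l) : GroupTable l.length :=
  GroupTable.ofEquiv (equivFinOfList l hnd hall)

/-- `GroupTable.ofList` is the table of `G` along the list numbering. [folklore] -/
theorem GroupTable.ofList_isTableOf {G : Type u} [Group G] [DecidableEq G] (l : List G)
    (hnd : l.Nodup) (hall : ∀ g, g ∈ l) :
    (GroupTable.ofList l hnd hall).IsTableOf G (equivFinOfList l hnd hall) :=
  GroupTable.ofEquiv_isTableOf _

/-! ### Basic TPP triples (w.l.o.g. `1 ∈ S ∩ T ∩ U`) -/

variable {G : Type u} [Group G]

/-- Right translation of each set preserves the triple product property (the special case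
`d = 1` of Hedtke–Murthy 2012, Lemma 2.9: `(Sa, Tb, Uc)` is again a TPP triple; the quotients
`(s a)(s' a)⁻¹ = s s'⁻¹` are unchanged). [cite: HedtkeMurthy2012, Lemma 2.9] -/
theorem TripleProductProperty.map_mulRight {S T U : Finset G} (h : TripleProductProperty S T U)
    (a b c : G) :
    TripleProductProperty (S.map (Equiv.mulRight a).toEmbedding)
      (T.map (Equiv.mulRight b).toEmbedding) (U.map (Equiv.mulRight c).toEmbedding) := by
  intro s hs s' hs' t ht t' ht' u hu u' hu' he
  simp only [Finset.mem_map_equiv] at hs hs' ht ht' hu hu'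
  -- `x ∈ S.map (mulRight a)` unfolds to `x * a⁻¹ ∈ S` via `(mulRight a).symm`
  simp only [Equiv.mulRight_symm_apply] at hs hs' ht ht' hu hu'
  have key : s * a⁻¹ * (s' * a⁻¹)⁻¹ * (t * b⁻¹ * (t' * b⁻¹)⁻¹) * (u * c⁻¹ * (u' * c⁻¹)⁻¹) = 1 := by
    simpa only [mul_inv_rev, inv_inv, mul_assoc, inv_mul_cancel_left] using he
  obtain ⟨h1, h2, h3⟩ := h _ hs _ hs' _ ht _ ht' _ hu _ hu' key
  exact ⟨mul_right_cancel h1, mul_right_cancel h2, mul_right_cancel h3⟩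

/-- **W.l.o.g. basic triples** (Hedtke–Murthy 2012, Def. 2.8 with Lemma 2.9): a TPP triple of
nonempty sets can be translated to a TPP triple of the same cardinalities containing `1` in each
set. [cite: HedtkeMurthy2012, Def. 2.8] -/
theorem exists_basic_tpp {S T U : Finset G} (h : TripleProductProperty S T U) (hS : S.Nonempty)
    (hT : T.Nonempty) (hU : U.Nonempty) :
    ∃ S' T' U' : Finset G, TripleProductProperty S' T' U' ∧ (1 : G) ∈ S' ∧ (1 : G) ∈ T' ∧
      (1 : G) ∈ U' ∧ S'.card = S.card ∧ T'.card = T.card ∧ U'.card = U.card := by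
  obtain ⟨s₀, hs₀⟩ := hS
  obtain ⟨t₀, ht₀⟩ := hT
  obtain ⟨u₀, hu₀⟩ := hU
  refine ⟨_, _, _, h.map_mulRight s₀⁻¹ t₀⁻¹ u₀⁻¹, ?_, ?_, ?_, Finset.card_map _, Finset.card_map _,
    Finset.card_map _⟩ <;>
    simp only [Finset.mem_map_equiv, Equiv.mulRight_symm_apply, inv_inv, one_mul] <;>
    assumption

/-! ### Variables and their numbering -/

/-- The variables of the TPP encoding for a group inside `Fin N`: membership bits `mem t g`
("`g ∈ X_t`") and quotient-set bits `quot t d` ("`d ∈ Q(X_t)`", an upper bound), `t : Fin 3`.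
[cite: HedtkeMurthy2012, Def. 1.1] -/
inductive TPPVar (N : ℕ) : Type
  /-- `g ∈ X_t` -/
  | mem (t : Fin 3) (g : Fin N)
  /-- `d ∈ Q(X_t)` (upper bound) -/
  | quot (t : Fin 3) (d : Fin N)
  deriving DecidableEq

namespace TPPVar

variable {N : ℕ}

/-- The DIMACS numbering of the base variables: `mem t g ↦ tN + g`, `quot t d ↦ 3N + tN + d`.
[folklore] -/
def code : TPPVar N → ℕ
  | mem t g => (t : ℕ) * N + g
  | quot t d => 3 * N + ((t : ℕ) * N + d)

/-- All base variables are numbered below `6N`. [folklore] -/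
theorem code_lt (x : TPPVar N) : x.code < 6 * N := by
  rcases x with ⟨t, g⟩ | ⟨t, d⟩
  · simp only [code]
    have ht := t.isLt; have hg := g.isLt
    calc (t : ℕ) * N + g < (t : ℕ) * N + N := by omega
      _ = ((t : ℕ) + 1) * N := by ring
      _ ≤ 6 * N := Nat.mul_le_mul_right _ (by omega)
  · simp only [code]
    have ht := t.isLt; have hd := d.isLt
    calc 3 * N + ((t : ℕ) * N + d) < 3 * N + ((t : ℕ) * N + N) := by omega
      _ = ((t : ℕ) + 4) * N := by ring
      _ ≤ 6 * N := Nat.mul_le_mul_right _ (by omega)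

/-- Uniqueness of quotient and remainder: `a·N + g = a'·N + g'` with `g, g' < N` forces
`a = a'`, `g = g'` (private twin of `HastadPV.Coding.mul_add_inj`). [folklore] -/
private theorem mul_add_inj {a a' g g' : ℕ} (hg : g < N) (hg' : g' < N)
    (h : a * N + g = a' * N + g') : a = a' ∧ g = g' := by
  have hN : 0 < N := lt_of_le_of_lt (Nat.zero_le g) hg
  have ha : (g + a * N) / N = a := by
    rw [Nat.add_mul_div_right _ _ hN, Nat.div_eq_of_lt hg, Nat.zero_add]
  have ha' : (g' + a' * N) / N = a' := by
    rw [Nat.add_mul_div_right _ _ hN, Nat.div_eq_of_lt hg', Nat.zero_add]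
  have haa : a = a' := by
    rw [← ha, ← ha', Nat.add_comm g, Nat.add_comm g', h]
  subst haa
  exact ⟨rfl, by omega⟩

/-- The numbering is injective. [folklore] -/
theorem code_injective : Function.Injective (code : TPPVar N → ℕ) := by
  intro x y hxy
  have aux : ∀ (t t' : Fin 3) (g g' : Fin N), (t : ℕ) * N + g = (t' : ℕ) * N + g' →
      t = t' ∧ g = g' := by
    intro t t' g g' h
    obtain ⟨h1, h2⟩ := mul_add_inj g.isLt g'.isLt h
    exact ⟨Fin.ext h1, Fin.ext h2⟩
  rcases x with ⟨t, g⟩ | ⟨t, d⟩ <;> rcases y with ⟨t', g'⟩ | ⟨t', d'⟩ <;> simp only [code] at hxy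
  · obtain ⟨rfl, rfl⟩ := aux t t' g g' hxy; rfl
  · exfalso
    have := (mem t g).code_lt; simp only [code] at this
    have h3 : (t : ℕ) * N + g < 3 * N := by
      have ht := t.isLt; have hg := g.isLt
      calc (t : ℕ) * N + g < ((t : ℕ) + 1) * N := by rw [Nat.add_mul, Nat.one_mul]; omega
        _ ≤ 3 * N := Nat.mul_le_mul_right _ (by omega)
    omega
  · exfalso
    have h3 : (t' : ℕ) * N + g' < 3 * N := by
      have ht := t'.isLt; have hg := g'.isLt
      calc (t' : ℕ) * N + g' < ((t' : ℕ) + 1) * N := by rw [Nat.add_mul, Nat.one_mul]; omega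
        _ ≤ 3 * N := Nat.mul_le_mul_right _ (by omega)
    omega
  · obtain ⟨rfl, rfl⟩ := aux t t' d d' (by omega); rfl

end TPPVar

/-! ### The encoding -/

section Encoding

variable {N : ℕ}

/-- The mask clauses `¬mem t i` for the points `i` that are not group elements. [folklore] -/
def tppMaskClauses (T : GroupTable N) : CNF (TPPVar N) :=
  (List.finRange 3).flatMap fun t => (List.finRange N).filterMap fun i =>
    if T.valid i then none else some [(TPPVar.mem t i, false)]

/-- The unit clauses `1 ∈ X_t` (basic triples). [cite: HedtkeMurthy2012, Def. 2.8] -/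
def tppUnitClauses (T : GroupTable N) : CNF (TPPVar N) :=
  (List.finRange 3).map fun t => [(TPPVar.mem t T.one, true)]

/-- The valid points (group elements) of the table, in order. [folklore] -/
def GroupTable.validPoints (T : GroupTable N) : List (Fin N) :=
  (List.finRange N).filter fun i => T.valid i

/-- A point is listed in `validPoints` iff it is valid. [folklore] -/
theorem GroupTable.mem_validPoints_iff (T : GroupTable N) {i : Fin N} :
    i ∈ T.validPoints ↔ T.valid i = true := by
  simp [GroupTable.validPoints]

/-- The quotient-set clauses of `X_t` over the valid points: `g, h ∈ X_t → g h⁻¹ ∈ Q(X_t)`, i.e.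
`¬mem t g ∨ ¬mem t h ∨ quot t (g h⁻¹)`. [cite: HedtkeMurthy2012, Def. 1.1] -/
def tppQuotClauses (T : GroupTable N) (t : Fin 3) : CNF (TPPVar N) :=
  T.validPoints.flatMap fun g => T.validPoints.map fun h =>
    [(TPPVar.mem t g, false), (TPPVar.mem t h, false), (TPPVar.quot t (T.mul g (T.inv h)), true)]

/-- The TPP clauses over the valid points: for `d₁, d₂` and `d₃ := (d₁ d₂)⁻¹` not all equal to
`1`, `¬quot 0 d₁ ∨ ¬quot 1 d₂ ∨ ¬quot 2 d₃`. [cite: HedtkeMurthy2012, Def. 1.2] -/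
def tppTripleClauses (T : GroupTable N) : CNF (TPPVar N) :=
  T.validPoints.flatMap fun d₁ => T.validPoints.filterMap fun d₂ =>
    if d₁ = T.one ∧ d₂ = T.one ∧ T.inv (T.mul d₁ d₂) = T.one then none
    else some [(TPPVar.quot 0 d₁, false), (TPPVar.quot 1 d₂, false),
      (TPPVar.quot 2 (T.inv (T.mul d₁ d₂)), false)]

/-- The membership variables of `X_t`, in order. [folklore] -/
def tppMemVars (N : ℕ) (t : Fin 3) : List (TPPVar N) :=
  (List.finRange N).map (TPPVar.mem t)

/-- **The TPP encoding as a CNF with cardinality constraints** over `TPPVar N`.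
[cite: HedtkeMurthy2012, Def. 1.2] -/
def tppCCNF (T : GroupTable N) (a b c : ℕ) : CCNF (TPPVar N) where
  clauses := tppMaskClauses T ++ tppUnitClauses T ++ (List.finRange 3).flatMap (tppQuotClauses T) ++
    tppTripleClauses T
  cards := [CardConstraint.atLeast a (tppMemVars N 0), CardConstraint.atLeast b (tppMemVars N 1),
    CardConstraint.atLeast c (tppMemVars N 2)]

/-- **The TPP encoding as a plain CNF over `ℕ`** (DIMACS-ready): base variables numbered by
`TPPVar.code` (below `6N`), counter bits after. See `tppCNF_satisfiable_iff`.
[cite: HedtkeMurthy2012, Def. 1.2] -/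
def tppCNF (T : GroupTable N) (a b c : ℕ) : CNF ℕ :=
  (tppCCNF T a b c).toCNF TPPVar.code (6 * N)

/-- The TPP encoding of a group along a numbering of its elements. [cite: HedtkeMurthy2012, Def. 1.2] -/
def tppCNFOf {G : Type u} [Group G] (e : G ≃ Fin N) (a b c : ℕ) : CNF ℕ :=
  tppCNF (GroupTable.ofEquiv e) a b c

/-- `tppCNF` and `tppCCNF` are equisatisfiable. [cite: Sinz2005, §2] -/
theorem tppCNF_satisfiable_iff_ccnf (T : GroupTable N) (a b c : ℕ) :
    (tppCNF T a b c).Satisfiable ↔ (tppCCNF T a b c).Satisfiable :=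
  CCNF.satisfiable_toCNF_iff' _ TPPVar.code_injective TPPVar.code_lt

end Encoding

/-! ### Correctness of the encoding -/

section Correctness

variable {N : ℕ} {T : GroupTable N} {ι : G → Fin N}

omit [Group G] in
/-- Counting membership bits over `Fin N` is the cardinality of the set of points whose bit is set.
[folklore] -/
theorem countP_tppMemVars (σ : TPPVar N → Bool) (t : Fin 3) :
    ((tppMemVars N t).countP fun x => σ x) =
      (Finset.univ.filter fun i : Fin N => σ (TPPVar.mem t i) = true).card := by
  rw [tppMemVars, List.countP_map, ← countP_finRange_eq_card_filter]
  rfl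

/-- The subset of `G` read off from the membership bits of `X_t` (finite group). [folklore] -/
def tppSetOf [Fintype G] (σ : TPPVar N → Bool) (ι : G → Fin N) (t : Fin 3) : Finset G :=
  Finset.univ.filter fun g : G => σ (TPPVar.mem t (ι g)) = true

omit [Group G] in
/-- Membership in `tppSetOf`. [folklore] -/
theorem mem_tppSetOf_iff [Fintype G] {σ : TPPVar N → Bool} {t : Fin 3} {x : G} :
    x ∈ tppSetOf σ ι t ↔ σ (TPPVar.mem t (ι x)) = true := by
  simp [tppSetOf]

/-- **Soundness of the TPP encoding**: a satisfying assignment of `tppCCNF T a b c` yields a TPP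
triple with `|S| ≥ a`, `|T| ≥ b`, `|U| ≥ c` (for a partial table of a finite group).
[cite: HedtkeMurthy2012, Def. 1.2] -/
theorem exists_tpp_of_satisfies [Fintype G] (hT : T.IsPartialTableOf G ι) {a b c : ℕ}
    {σ : TPPVar N → Bool} (hσ : (tppCCNF T a b c).Satisfies σ) :
    ∃ S₁ S₂ S₃ : Finset G, TripleProductProperty S₁ S₂ S₃ ∧ a ≤ S₁.card ∧ b ≤ S₂.card ∧
      c ≤ S₃.card := by
  obtain ⟨hcl, hcard⟩ := hσ
  rw [CNF.eval_eq_true_iff] at hcl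
  -- codes of group elements are valid points
  have hιv : ∀ x : G, ι x ∈ T.validPoints := fun x =>
    T.mem_validPoints_iff.2 ((hT.valid_iff _).2 ⟨x, rfl⟩)
  -- the quotient bits bound the quotient sets from above
  have hquot : ∀ (t : Fin 3) (x y : G), x ∈ tppSetOf σ ι t → y ∈ tppSetOf σ ι t →
      σ (TPPVar.quot t (ι (x * y⁻¹))) = true := by
    intro t x y hx hy
    rw [mem_tppSetOf_iff] at hx hy
    have hmem : [(TPPVar.mem t (ι x), false), (TPPVar.mem t (ι y), false),
        (TPPVar.quot t (T.mul (ι x) (T.inv (ι y))), true)] ∈ (tppCCNF T a b c).clauses := by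
      simp only [tppCCNF, List.mem_append]
      exact Or.inl (Or.inr (List.mem_flatMap.2 ⟨t, List.mem_finRange _, List.mem_flatMap.2
        ⟨ι x, hιv x, List.mem_map.2 ⟨ι y, hιv y, rfl⟩⟩⟩))
    have := hcl _ hmem
    rw [hT.inv_eq, hT.mul_eq] at this
    simpa [Clause.eval, Literal.eval, hx, hy] using this
  -- set membership bits are only on valid points, i.e. on codes of group elements
  have hvalid : ∀ (t : Fin 3) (i : Fin N), σ (TPPVar.mem t i) = true → ∃ g, ι g = i := by
    intro t i hi
    rw [← hT.valid_iff]
    by_contra hv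
    have hmem : [(TPPVar.mem t i, false)] ∈ (tppCCNF T a b c).clauses := by
      simp only [tppCCNF, List.mem_append]
      refine Or.inl (Or.inl (Or.inl (List.mem_flatMap.2 ⟨t, List.mem_finRange _, ?_⟩)))
      rw [List.mem_filterMap]
      exact ⟨i, List.mem_finRange _, by simp [hv]⟩
    have := hcl _ hmem
    simp [Clause.eval, Literal.eval, hi] at this
  -- hence the count of set bits is at most the size of the decoded set
  have hcount : ∀ t : Fin 3, ((tppMemVars N t).countP fun x => σ x) ≤ (tppSetOf σ ι t).card := by
    intro t
    rw [countP_tppMemVars, ← Finset.card_image_of_injective (tppSetOf σ ι t) hT.injective]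
    refine Finset.card_le_card fun i hi => ?_
    simp only [Finset.mem_filter, Finset.mem_univ, true_and] at hi
    obtain ⟨g, rfl⟩ := hvalid t i hi
    exact Finset.mem_image.2 ⟨g, mem_tppSetOf_iff.2 hi, rfl⟩
  refine ⟨tppSetOf σ ι 0, tppSetOf σ ι 1, tppSetOf σ ι 2, ?_, ?_, ?_, ?_⟩
  · intro s hs s' hs' t ht t' ht' u hu u' hu' hprod
    have h1 := hquot 0 s s' hs hs'
    have h2 := hquot 1 t t' ht ht'
    have h3 := hquot 2 u u' hu hu'
    -- `d₃ = (d₁ d₂)⁻¹` is the quotient `u u'⁻¹`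
    have hd3 : T.inv (T.mul (ι (s * s'⁻¹)) (ι (t * t'⁻¹))) = ι (u * u'⁻¹) := by
      rw [hT.mul_eq, hT.inv_eq]
      congr 1
      exact inv_eq_of_mul_eq_one_right hprod
    by_contra hne
    -- the TPP clause for `(d₁, d₂)` exists unless all three quotients are `1`
    by_cases hall : ι (s * s'⁻¹) = T.one ∧ ι (t * t'⁻¹) = T.one ∧
        T.inv (T.mul (ι (s * s'⁻¹)) (ι (t * t'⁻¹))) = T.one
    · apply hne
      rw [hd3, hT.one_eq] at hall
      obtain ⟨h1', h2', h3'⟩ := hall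
      exact ⟨mul_inv_eq_one.1 (hT.injective h1'), mul_inv_eq_one.1 (hT.injective h2'),
        mul_inv_eq_one.1 (hT.injective h3')⟩
    · have hmem : [(TPPVar.quot 0 (ι (s * s'⁻¹)), false), (TPPVar.quot 1 (ι (t * t'⁻¹)), false),
          (TPPVar.quot 2 (T.inv (T.mul (ι (s * s'⁻¹)) (ι (t * t'⁻¹)))), false)] ∈
          (tppCCNF T a b c).clauses := by
        simp only [tppCCNF, List.mem_append]
        refine Or.inr (List.mem_flatMap.2 ⟨ι (s * s'⁻¹), hιv _, ?_⟩)
        rw [List.mem_filterMap]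
        exact ⟨ι (t * t'⁻¹), hιv _, by rw [if_neg hall]⟩
      have := hcl _ hmem
      rw [hd3] at this
      simp [Clause.eval, Literal.eval, h1, h2, h3] at this
  · have := hcard (CardConstraint.atLeast a (tppMemVars N 0)) (by simp [tppCCNF])
    rw [CardConstraint.holds_atLeast_iff] at this
    exact this.trans (hcount 0)
  · have := hcard (CardConstraint.atLeast b (tppMemVars N 1)) (by simp [tppCCNF])
    rw [CardConstraint.holds_atLeast_iff] at this
    exact this.trans (hcount 1)
  · have := hcard (CardConstraint.atLeast c (tppMemVars N 2)) (by simp [tppCCNF])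
    rw [CardConstraint.holds_atLeast_iff] at this
    exact this.trans (hcount 2)

/-- The assignment encoding a triple of subsets: membership bits exactly on the codes of members,
quotient bits exactly on the codes of quotients. [cite: HedtkeMurthy2012, Def. 1.1] -/
noncomputable def tppAssignment (ι : G → Fin N) (X : Fin 3 → Finset G) : TPPVar N → Bool := by
  classical
  exact fun
    | TPPVar.mem t i => decide (∃ g ∈ X t, ι g = i)
    | TPPVar.quot t d => decide (∃ x ∈ X t, ∃ y ∈ X t, ι (x * y⁻¹) = d)

/-- **Completeness of the TPP encoding**: a basic TPP triple with `|S| ≥ a`, `|T| ≥ b`,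
`|U| ≥ c` yields a satisfying assignment of `tppCCNF T a b c` (for a partial table).
[cite: HedtkeMurthy2012, Def. 1.2] -/
theorem satisfies_tppAssignment (hT : T.IsPartialTableOf G ι) {a b c : ℕ} {X : Fin 3 → Finset G}
    (htpp : TripleProductProperty (X 0) (X 1) (X 2)) (hone : ∀ t, (1 : G) ∈ X t)
    (ha : a ≤ (X 0).card) (hb : b ≤ (X 1).card) (hc : c ≤ (X 2).card) :
    (tppCCNF T a b c).Satisfies (tppAssignment ι X) := by
  classical
  have hmem : ∀ (t : Fin 3) (i : Fin N), tppAssignment ι X (TPPVar.mem t i) = true ↔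
      ∃ g ∈ X t, ι g = i := by
    intro t i; simp [tppAssignment]
  have hmem' : ∀ (t : Fin 3) (g : G), tppAssignment ι X (TPPVar.mem t (ι g)) = true ↔ g ∈ X t := by
    intro t g
    rw [hmem]
    exact ⟨fun ⟨g', hg', hgg'⟩ => hT.injective hgg' ▸ hg', fun hg => ⟨g, hg, rfl⟩⟩
  have hquot : ∀ (t : Fin 3) (d : Fin N), tppAssignment ι X (TPPVar.quot t d) = true ↔
      ∃ x ∈ X t, ∃ y ∈ X t, ι (x * y⁻¹) = d := by
    intro t d; simp [tppAssignment]
  refine ⟨?_, ?_⟩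
  · rw [CNF.eval_eq_true_iff]
    intro cl hcl
    simp only [tppCCNF, List.mem_append] at hcl
    rcases hcl with ((hcl | hcl) | hcl) | hcl
    · -- mask clauses
      obtain ⟨t, -, hcl⟩ := List.mem_flatMap.1 hcl
      obtain ⟨i, -, hcl⟩ := List.mem_filterMap.1 hcl
      split_ifs at hcl with hv
      simp only [Option.some.injEq] at hcl
      subst hcl
      have : tppAssignment ι X (TPPVar.mem t i) = false := by
        rw [Bool.eq_false_iff, Ne, hmem]
        rintro ⟨g, -, rfl⟩
        exact hv ((hT.valid_iff _).2 ⟨g, rfl⟩)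
      simp [Clause.eval, Literal.eval, this]
    · -- unit clauses
      obtain ⟨t, -, rfl⟩ := List.mem_map.1 hcl
      have : tppAssignment ι X (TPPVar.mem t T.one) = true := by
        rw [hT.one_eq, hmem']; exact hone t
      simp [Clause.eval, Literal.eval, this]
    · -- quotient clauses
      obtain ⟨t, -, hcl⟩ := List.mem_flatMap.1 hcl
      obtain ⟨g, -, hcl⟩ := List.mem_flatMap.1 hcl
      obtain ⟨h, -, rfl⟩ := List.mem_map.1 hcl
      by_cases hg : tppAssignment ι X (TPPVar.mem t g) = true
      · by_cases hh : tppAssignment ι X (TPPVar.mem t h) = true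
        · obtain ⟨x, hx, rfl⟩ := (hmem t g).1 hg
          obtain ⟨y, hy, rfl⟩ := (hmem t h).1 hh
          have hq : tppAssignment ι X (TPPVar.quot t (T.mul (ι x) (T.inv (ι y)))) = true := by
            rw [hT.inv_eq, hT.mul_eq, hquot]
            exact ⟨x, hx, y, hy, rfl⟩
          simp [Clause.eval, Literal.eval, hq]
        · simp [Clause.eval, Literal.eval, hh]
      · simp [Clause.eval, Literal.eval, hg]
    · -- TPP clauses
      obtain ⟨d₁, -, hcl⟩ := List.mem_flatMap.1 hcl
      obtain ⟨d₂, -, hcl⟩ := List.mem_filterMap.1 hcl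
      split_ifs at hcl with hall
      simp only [Option.some.injEq] at hcl
      subst hcl
      -- not all three quotient bits can be set
      by_contra hfalse
      have hq : tppAssignment ι X (TPPVar.quot 0 d₁) = true ∧
          tppAssignment ι X (TPPVar.quot 1 d₂) = true ∧
          tppAssignment ι X (TPPVar.quot 2 (T.inv (T.mul d₁ d₂))) = true := by
        simpa [Clause.eval, Literal.eval] using hfalse
      obtain ⟨hq1, hq2, hq3⟩ := hq
      rw [hquot] at hq1 hq2 hq3
      obtain ⟨s, hs, s', hs', rfl⟩ := hq1
      obtain ⟨t, ht, t', ht', rfl⟩ := hq2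
      obtain ⟨u, hu, u', hu', hu3⟩ := hq3
      rw [hT.mul_eq, hT.inv_eq] at hu3 hall
      have hu3' := hT.injective hu3
      have hprod : s * s'⁻¹ * (t * t'⁻¹) * (u * u'⁻¹) = 1 := by
        rw [hu3', mul_inv_cancel]
      obtain ⟨rfl, rfl, rfl⟩ := htpp s hs s' hs' t ht t' ht' u hu u' hu' hprod
      apply hall
      simp [hT.one_eq]
  · intro cc hcc
    simp only [tppCCNF, List.mem_cons, List.not_mem_nil, or_false] at hcc
    have hcount : ∀ t : Fin 3, ((tppMemVars N t).countP fun x => tppAssignment ι X x) =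
        (X t).card := by
      intro t
      rw [countP_tppMemVars _ t, ← Finset.card_image_of_injective (X t) hT.injective]
      congr 1
      ext i
      simp only [Finset.mem_filter, Finset.mem_univ, true_and, hmem, Finset.mem_image]
    rcases hcc with rfl | rfl | rfl <;>
      rw [CardConstraint.holds_atLeast_iff, hcount] <;> assumption

/-- **The TPP encoding is exact (partial tables)**: for a table `T` containing the finite group
`G` along the injection `ι` and thresholds `a, b, c ≥ 1`, `tppCNF T a b c` is satisfiable iff `G`
has subsets `S, T, U` with the triple product property and `|S| ≥ a`, `|T| ≥ b`, `|U| ≥ c`.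
[cite: HedtkeMurthy2012, Def. 1.2] -/
theorem tppCNF_satisfiable_iff_of_partial [Fintype G] (hT : T.IsPartialTableOf G ι) {a b c : ℕ}
    (ha : 0 < a) (hb : 0 < b) (hc : 0 < c) :
    (tppCNF T a b c).Satisfiable ↔ ∃ S₁ S₂ S₃ : Finset G, TripleProductProperty S₁ S₂ S₃ ∧
      a ≤ S₁.card ∧ b ≤ S₂.card ∧ c ≤ S₃.card := by
  rw [tppCNF_satisfiable_iff_ccnf]
  constructor
  · rintro ⟨σ, hσ⟩
    exact exists_tpp_of_satisfies hT hσ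
  · rintro ⟨S₁, S₂, S₃, htpp, h1, h2, h3⟩
    obtain ⟨S₁', S₂', S₃', htpp', ho1, ho2, ho3, hc1, hc2, hc3⟩ := exists_basic_tpp htpp
      (Finset.card_pos.1 (ha.trans_le h1)) (Finset.card_pos.1 (hb.trans_le h2))
      (Finset.card_pos.1 (hc.trans_le h3))
    let X : Fin 3 → Finset G := ![S₁', S₂', S₃']
    have hone : ∀ t, (1 : G) ∈ X t := by
      intro t; fin_cases t <;> assumption
    exact ⟨tppAssignment ι X, satisfies_tppAssignment hT (X := X) htpp' hone
      (by simpa [X, hc1] using h1) (by simpa [X, hc2] using h2) (by simpa [X, hc3] using h3)⟩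

/-- **Nonexistence from UNSAT (partial tables)**: if `tppCNF T a b c` is unsatisfiable
(`a, b, c ≥ 1`), the finite group `G` inside `T` has no TPP triple with `|S| ≥ a`, `|T| ≥ b`,
`|U| ≥ c`. [cite: HedtkeMurthy2012, Def. 1.2] -/
theorem not_exists_tpp_of_not_satisfiable_of_partial [Fintype G] (hT : T.IsPartialTableOf G ι)
    {a b c : ℕ} (ha : 0 < a) (hb : 0 < b) (hc : 0 < c) (h : ¬ (tppCNF T a b c).Satisfiable) :
    ¬ ∃ S₁ S₂ S₃ : Finset G, TripleProductProperty S₁ S₂ S₃ ∧ a ≤ S₁.card ∧ b ≤ S₂.card ∧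
      c ≤ S₃.card :=
  fun hex => h ((tppCNF_satisfiable_iff_of_partial hT ha hb hc).2 hex)

variable {e : G ≃ Fin N}

/-- **The TPP encoding is exact**: for the table `T` of `G` (along `e`) and thresholds
`a, b, c ≥ 1`, `tppCNF T a b c` is satisfiable iff `G` has subsets `S, T, U` with the triple
product property and `|S| ≥ a`, `|T| ≥ b`, `|U| ≥ c`. [cite: HedtkeMurthy2012, Def. 1.2] -/
theorem tppCNF_satisfiable_iff (hT : T.IsTableOf G e) {a b c : ℕ} (ha : 0 < a) (hb : 0 < b)
    (hc : 0 < c) :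
    (tppCNF T a b c).Satisfiable ↔ ∃ S₁ S₂ S₃ : Finset G, TripleProductProperty S₁ S₂ S₃ ∧
      a ≤ S₁.card ∧ b ≤ S₂.card ∧ c ≤ S₃.card := by
  haveI : Fintype G := Fintype.ofEquiv _ e.symm
  exact tppCNF_satisfiable_iff_of_partial hT.isPartialTableOf ha hb hc

/-- **Nonexistence from UNSAT** (the direction used with imported certificates): if
`tppCNF T a b c` is unsatisfiable (`a, b, c ≥ 1`), then `G` has no TPP triple with `|S| ≥ a`,
`|T| ≥ b`, `|U| ≥ c`; in particular `G` does not realize `⟨a, b, c⟩`.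
[cite: HedtkeMurthy2012, Def. 1.2] -/
theorem not_exists_tpp_of_not_satisfiable (hT : T.IsTableOf G e) {a b c : ℕ} (ha : 0 < a)
    (hb : 0 < b) (hc : 0 < c) (h : ¬ (tppCNF T a b c).Satisfiable) :
    ¬ ∃ S₁ S₂ S₃ : Finset G, TripleProductProperty S₁ S₂ S₃ ∧ a ≤ S₁.card ∧ b ≤ S₂.card ∧
      c ≤ S₃.card :=
  fun hex => h ((tppCNF_satisfiable_iff hT ha hb hc).2 hex)

/-- The exactness statement for the encoding of a group along a numbering `e`.
[cite: HedtkeMurthy2012, Def. 1.2] -/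
theorem tppCNFOf_satisfiable_iff (e : G ≃ Fin N) {a b c : ℕ} (ha : 0 < a) (hb : 0 < b)
    (hc : 0 < c) :
    (tppCNFOf e a b c).Satisfiable ↔ ∃ S₁ S₂ S₃ : Finset G, TripleProductProperty S₁ S₂ S₃ ∧
      a ≤ S₁.card ∧ b ≤ S₂.card ∧ c ≤ S₃.card :=
  tppCNF_satisfiable_iff (GroupTable.ofEquiv_isTableOf e) ha hb hc

end Correctness

end Literature.Combinatorics.Additive
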